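import Literature.AnabelianGeometry.EtaleTheta.Thm56SubdagStatements
import Literature.AnabelianGeometry.EtaleTheta.FrobenioidThetaOfBiKummerData
import Literature.AnabelianGeometry.EtaleTheta.ThetaRigidity

/-!
# [EtTh] Thm. 5.6 (i), proof p.329 (PDF p.103) l.1 + l.17–21 — the sub-DAG input T56-L09c
# `Thm56Sub.DeltaTransportCompat` DERIVED from its printed sources (proof-only)

Mochizuki, *The étale theta function and its Frobenioid-theoretic manifestations*, Publ. RIMS **45** (2009)
[MochizukiEtTh2009], proof of Thm. 5.6, p.329 (PDF p.103): «`Ψ` … induces a 1-compatible equivalence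
`Ψ^bs : D ⥲ D`, hence [cf. [SemiAnbd], Proposition 3.2] an outer automorphism of the tempered fundamental group …
In particular, it follows from Propositions 2.4, 2.6 that `Ψ` preserves "`(l·Δ_Θ)_{(−)}`"» — and p.327 (PDF p.101):
«the subquotients `Π^tp_X ↠ (Π^tp_X)^Θ ⊇ l·Δ_Θ` … determine subquotients `Aut_D(D) ↠ Aut^Θ_D(D) ⊇ (l·Δ_Θ)_D`».

abc-iut cell, layer L2, ROW «galoisSurj NATURALITY cluster at the canonical model» (abc-iut-L2-lead 2026-08-26T02:54:52Z,
seat abc-iut-w5-d013 gen 2), deliverable (D): SUBDAG-EtTh-Thm56 leaf **T56-L09c** (plan/L2/SUBDAG-EtTh-Thm56.md; typed by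
abc-iut-w5-d020 as `ThetaFrobenioid.Thm56Sub.DeltaTransportCompat Ψ β aΨ θ P`, Thm56SubdagStatements.lean l.218, and
consumed by `Thm56Sub.transportAtBN_of` = T56-L09).  PROOF-ONLY (0 definitions, 0 new named facts).

WHAT IS PROVED.  `DeltaTransportCompat` compares, at `B_N`, four mutually abstract data of the §5 interface — the
Δ-transport `aΨ` (abc-iut-L2-d4's parameter), the base transport `θ` of `Aut_D(B_N^bs)` (abc-iut-L2-t4's
`StrvTransport`), the subquotient datum `P = (pre, proj)` and `lDeltaMap` (through `lDeltaModNMap β.hom`).  In print all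
four are shadows of ONE automorphism `γ` of `Π^tp_X` (the outer automorphism induced by `Ψ^bs`, [SemiAnbd] Prop. 3.2 =
sub-node T56-L02) read through the Galois surjection `ρ : Π^tp_X ↠ Aut_D(B_N^bs)` (Def. 4.1 (ii)) and the preimage
`θ⁻¹(l·Δ_Θ) ⊆ Π^tp_X` of `l·Δ_Θ` with its reduction `thetaMod : θ⁻¹(l·Δ_Θ) ↠ (l·Δ_Θ) ⊗ ℤ/Nℤ = μ_N` (abc-iut-L2-t2's
`RigidData`).  `deltaTransportCompat_of` DERIVES T56-L09c from exactly these printed relations, each a hypothesis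
BINDER in field shape (never asserted):
* `hγ`  — **T56-L02** ([SemiAnbd] Prop. 3.2; the NATURALITY of the Galois surjection along `Ψ^bs`, cf.
  `Discharge/Sec4GaloisSurjNatural`): `θ ∘ ρ = ρ ∘ γ` on `Π^tp_X`;
* `hγL` — **Props. 2.4, 2.6** (p.329 l.1): `γ` stabilises `θ⁻¹(l·Δ_Θ)`;
* `haΨ` — **T56-L03** (the definition-level pin of abc-iut-L2-d4's parameter `aΨ` at `B_N`, owner abc-iut-L2-t9
  `ThetaSubquotientOfTempered`): read through `β : Ψ(B_N) ⥲ B_N` and the coefficient identification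
  `e : μ_N → (l·Δ_Θ)_{B_N} ⊗ ℤ/Nℤ`, `aΨ_{B_N}` is the map induced by `γ` on `(l·Δ_Θ) ⊗ ℤ/Nℤ`;
* `hcov`, `hpre`, `hP` — the **row-2 laws** of the real subquotient datum at `B_N^bs` (MERGE-PLAN row 2, GAP-LEDGER
  G-w5d123-2; `hpre`/`hP` VERBATIM the binders of abc-iut-w5-d123's `lDeltaCovered_ofBiKummerData` /
  `exists_eta_etaTautological_ofBiKummerData`; `hcov` the converse inclusion `P.pre(B_N^bs) ⊆ ρ(θ⁻¹(l·Δ_Θ))`, which is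
  the p.327 DEFINITION of `(l·Δ_Θ)_{B_N}` as the image of `l·Δ_Θ`).
`deltaTransportCompat_ofBiKummerData` is the same AT THE GENUINE §5 DATA `ThetaFrobenioid.ofBiKummerData` (abc-iut-L2-t4,
W3-L2-01) over a §2 `RigidData`, with `ρ = rhoOfBiKummerData` and `γ : Π^tp_X ≃ₜ* Π^tp_X` a continuous automorphism,
binders in abc-iut-w5-d123's shapes.  HONEST FRAMING: conditional on the named binders; [EtTh] is a refereed paper,
nothing of it is asserted; typed ≠ proved; nothing here bears on [IUTchIII] Cor. 3.12.
-/

noncomputable section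

namespace Literature.AnabelianGeometry.EtaleTheta

open CategoryTheory FrobenioidCyclotomicRigidity Literature.AlgebraicGeometry.Frobenioids

universe u₀ v₀ u v w u' v'

namespace ThetaFrobenioid

namespace Thm56Sub

section Abstract

variable {C : Type u} [Category.{v} C] {D : Type u'} [Category.{v'} D] (𝔉 : ThetaFrobenioid.{w} C D)

/-- **EtTh:Thm5.6(i)/T56-L09c DERIVED from T56-L02 + Props. 2.4/2.6 + the row-2 laws** (proof of Thm. 5.6, p.329
(PDF p.103) l.1, l.17–21; p.327 (PDF p.101)).  For the §5 data `𝔉`, a subgroup `L ⊆ Π^tp_X` (printed: `θ⁻¹(l·Δ_Θ)`)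
with a reduction `tm : L → M` (printed: onto `(l·Δ_Θ) ⊗ ℤ/Nℤ = μ_N`) and `e : M → (l·Δ_Θ)_{B_N} ⊗ ℤ/Nℤ`, and a map
`γ : Π^tp_X → Π^tp_X` (printed: the automorphism induced by `Ψ^bs`): IF `θ ∘ ρ = ρ ∘ γ` on `L` (`hγ`, T56-L02), `γ(L) ⊆ L`
(`hγL`, Props. 2.4/2.6), `aΨ_{B_N}` read through `β` and `e` is induced by `γ` (`haΨ`, T56-L03), and `P` at `B_N^bs` is
the image of `L` under `ρ` with `proj ∘ ρ = e ∘ tm` (`hcov`, `hpre`, `hP`, row 2), THEN `DeltaTransportCompat 𝔉 Ψ β aΨ θ P`.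
[cite: MochizukiEtTh2009, Thm 5.6 proof p.329 (PDF p.103)] -/
theorem deltaTransportCompat_of (Ψ : C ≌ C) (β : Ψ.functor.obj 𝔉.BN ≅ 𝔉.BN)
    (aΨ : ∀ S : C, 𝔉.lDeltaModN S ≃* 𝔉.lDeltaModN (Ψ.functor.obj S))
    (θ : Aut (𝔉.base.obj 𝔉.BN) ≃* Aut (𝔉.base.obj 𝔉.BN)) (P : ThetaSubquotientProj 𝔉)
    (L : Subgroup 𝔉.PiX) {M : Type*} (tm : L → M) (e : M → 𝔉.lDeltaModN 𝔉.BN) (γ : 𝔉.PiX → 𝔉.PiX)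
    (hγ : ∀ k : 𝔉.PiX, k ∈ L → θ (𝔉.ρ k) = 𝔉.ρ (γ k))
    (hγL : ∀ k : 𝔉.PiX, k ∈ L → γ k ∈ L)
    (haΨ : ∀ (k : 𝔉.PiX) (hk : k ∈ L),
      𝔉.lDeltaModNMap β.hom (aΨ 𝔉.BN (e (tm ⟨k, hk⟩))) = e (tm ⟨γ k, hγL k hk⟩))
    (hcov : ∀ g ∈ P.pre (𝔉.base.obj 𝔉.BN), ∃ k ∈ L, 𝔉.ρ k = g)
    (hpre : ∀ k : 𝔉.PiX, k ∈ L → 𝔉.ρ k ∈ P.pre (𝔉.base.obj 𝔉.BN))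
    (hP : ∀ (k : 𝔉.PiX) (hk : k ∈ L) (hm : 𝔉.ρ k ∈ P.pre (𝔉.base.obj 𝔉.BN)),
      (QuotientGroup.mk (P.proj _ ⟨𝔉.ρ k, hm⟩) : 𝔉.lDeltaModN 𝔉.BN) = e (tm ⟨k, hk⟩)) :
    DeltaTransportCompat 𝔉 Ψ β aΨ θ P := by
  intro g hg
  obtain ⟨k, hk, rfl⟩ := hcov g hg
  have hmem : θ (𝔉.ρ k) ∈ P.pre (𝔉.base.obj 𝔉.BN) := by
    rw [hγ k hk]
    exact hpre _ (hγL k hk)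
  refine ⟨hmem, ?_⟩
  rw [hP k hk hg, haΨ k hk]
  have hsub : (⟨θ (𝔉.ρ k), hmem⟩ : P.pre (𝔉.base.obj 𝔉.BN)) = ⟨𝔉.ρ (γ k), hpre _ (hγL k hk)⟩ :=
    Subtype.ext (hγ k hk)
  rw [hsub, hP (γ k) (hγL k hk)]

/-- **T56-L09c, the membership clause alone** (p.329 l.1 «`Ψ` preserves "`(l·Δ_Θ)_{(−)}`"» at `B_N^bs`): under
T56-L02 (`hγ`), Props. 2.4/2.6 (`hγL`) and the row-2 image laws (`hcov`, `hpre`), the base transport `θ` stabilises the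
part `P.pre(B_N^bs)` of `Aut_D(B_N^bs)` over `(l·Δ_Θ)_{B_N}`. [cite: MochizukiEtTh2009, Thm 5.6 proof p.329 (PDF p.103)] -/
theorem pre_stable_of (θ : Aut (𝔉.base.obj 𝔉.BN) ≃* Aut (𝔉.base.obj 𝔉.BN)) (P : ThetaSubquotientProj 𝔉)
    (L : Subgroup 𝔉.PiX) (γ : 𝔉.PiX → 𝔉.PiX)
    (hγ : ∀ k : 𝔉.PiX, k ∈ L → θ (𝔉.ρ k) = 𝔉.ρ (γ k)) (hγL : ∀ k : 𝔉.PiX, k ∈ L → γ k ∈ L)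
    (hcov : ∀ g ∈ P.pre (𝔉.base.obj 𝔉.BN), ∃ k ∈ L, 𝔉.ρ k = g)
    (hpre : ∀ k : 𝔉.PiX, k ∈ L → 𝔉.ρ k ∈ P.pre (𝔉.base.obj 𝔉.BN))
    (g : Aut (𝔉.base.obj 𝔉.BN)) (hg : g ∈ P.pre (𝔉.base.obj 𝔉.BN)) :
    θ g ∈ P.pre (𝔉.base.obj 𝔉.BN) := by
  obtain ⟨k, hk, rfl⟩ := hcov g hg
  rw [hγ k hk]
  exact hpre _ (hγL k hk)

end Abstract

/-! ### At the genuine §5 data `ofBiKummerData` over a §2 `RigidData` -/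

section Genuine

variable {K : Type u₀} [Field K]
  {X : SemiGraphs.TemperedArithmeticGroup.{u₀} K} {D₀ : Type u₀} [Category.{v₀} D₀]
  {V : FrdIMonoidStub.{w}} {T₀ : RealifiedDivisorMonoids (D₀ := D₀) V} {D : Type u} [Category.{v} D]
  {VD : FrdICatStub.{u, v, w} D} {S : BiKummerSetting X T₀ D VD}
  {pullFrac : ∀ {A A' : S.C} (_ : A' ⟶ A), S.biratUnits A → S.biratUnits A'}
  {lv N : ℕ+} {l' : ℕ} {RD : RigidData.{max v w} N l'} {θ : S.biratUnits S.Aodot} {Bl : S.C}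
  {Pl : S.FractionPair θ Bl} {Rl : S.NthRoot θ Pl lv pullFrac}
  (h : ModelFrobenioid.Hypotheses S.tf.divisorMonoid S.tf.ratFnFunctor)
  (toB : ∀ A : S.C, S.biratUnits A →* S.tf.biratUnitsModel A) (Q : FrobenioidTheta.ThetaSubquotientStub.{w} D)
  (odd_l : Odd (lv : ℕ)) (R : S.NthRoot Rl.root Rl.pair N pullFrac) (ιX : RD.PiX ≃ₜ* X.Pi)
  (hopen : IsOpen ((S.galoisSurj R.AN.base R.αData.isGalois).ker : Set X.Pi)) (σ : Aut R.AN.base →* Aut R.AN)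
  (K' : Type w) [Field K'] (constEmb : K'ˣ →* S.tf.biratUnitsModel R.BN)
  (constEmb_injective : Function.Injective constEmb)
  (hdivc : ∀ g : Aut R.BN.base,
    ModelFrobenioid.div ((σ ((BiKummerSetting.NthRoot.baseIso S R).conjAut.symm g)).hom ≫ R.pair.num) =
      ModelFrobenioid.div R.pair.num)
  (hdivp : ∀ y : RD.PiYdd,
    ModelFrobenioid.div ((σ (S.galoisSurj R.AN.base R.αData.isGalois (ιX y.1))).hom ≫ R.pair.den) =
      ModelFrobenioid.div R.pair.den)

/-- **EtTh:Thm5.6(i)/T56-L09c AT THE GENUINE §5 DATA** (`𝔉 := ofBiKummerData …`, `ρ = rhoOfBiKummerData R ιX : Π^tp_X ↠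
Aut_D(B_N^bs)`): for a continuous automorphism `γ` of `Π^tp_X` with `θ ∘ ρ = ρ ∘ γ` (`hγ`: T56-L02, [SemiAnbd] Prop. 3.2 —
the outer automorphism induced by `Ψ^bs`, of which the base transport `θ` of abc-iut-L2-t4's `StrvTransport` is the shadow
on `Aut_D(B_N^bs)`), stabilising `θ⁻¹(l·Δ_Θ)` (`hγL`: Props. 2.4/2.6, in the `Subgroup.map … = …` shape of abc-iut-L2-t2's
`ExtendsStabilising`), with abc-iut-L2-d4's `aΨ` at `B_N` induced by `γ` on `(l·Δ_Θ) ⊗ ℤ/Nℤ = μ_N` (`haΨ`: T56-L03), and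
the row-2 laws `hpre`/`hP` of abc-iut-w5-d123 (verbatim) plus the image law `hcov` (p.327: `(l·Δ_Θ)_{B_N}` IS the image
of `l·Δ_Θ`), `DeltaTransportCompat` HOLDS.  [cite: MochizukiEtTh2009, Thm 5.6 proof p.329 (PDF p.103)] -/
theorem deltaTransportCompat_ofBiKummerData
    (e : RD.mu → (ofBiKummerData h toB Q odd_l R ιX hopen σ K' constEmb constEmb_injective hdivc hdivp).lDeltaModN
      (ofBiKummerData h toB Q odd_l R ιX hopen σ K' constEmb constEmb_injective hdivc hdivp).BN)
    (P : ThetaSubquotientProj (ofBiKummerData h toB Q odd_l R ιX hopen σ K' constEmb constEmb_injective hdivc hdivp))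
    (hpre : ∀ k : RD.PiYdd, (k : RD.PiX) ∈ RD.lDeltaTheta → rhoOfBiKummerData R ιX k ∈ P.pre _)
    (hP : ∀ (k : RD.PiYdd) (hk : (k : RD.PiX) ∈ RD.lDeltaTheta) (hm : rhoOfBiKummerData R ιX k ∈ P.pre _),
      (QuotientGroup.mk (P.proj _ ⟨rhoOfBiKummerData R ιX k, hm⟩) :
          (ofBiKummerData h toB Q odd_l R ιX hopen σ K' constEmb constEmb_injective hdivc hdivp).lDeltaModN
            (ofBiKummerData h toB Q odd_l R ιX hopen σ K' constEmb constEmb_injective hdivc hdivp).BN) =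
        e (RD.thetaMod ⟨k, hk⟩))
    (hcov : ∀ g ∈ P.pre ((ofBiKummerData h toB Q odd_l R ιX hopen σ K' constEmb constEmb_injective hdivc hdivp).base.obj
        (ofBiKummerData h toB Q odd_l R ιX hopen σ K' constEmb constEmb_injective hdivc hdivp).BN),
      ∃ k : RD.PiYdd, (k : RD.PiX) ∈ RD.lDeltaTheta ∧ rhoOfBiKummerData R ιX k = g)
    (Ψ : S.C ≌ S.C)
    (β : Ψ.functor.obj (ofBiKummerData h toB Q odd_l R ιX hopen σ K' constEmb constEmb_injective hdivc hdivp).BN ≅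
      (ofBiKummerData h toB Q odd_l R ιX hopen σ K' constEmb constEmb_injective hdivc hdivp).BN)
    (aΨ : ∀ A : S.C,
      (ofBiKummerData h toB Q odd_l R ιX hopen σ K' constEmb constEmb_injective hdivc hdivp).lDeltaModN A ≃*
        (ofBiKummerData h toB Q odd_l R ιX hopen σ K' constEmb constEmb_injective hdivc hdivp).lDeltaModN
          (Ψ.functor.obj A))
    (θΨ : Aut R.BN.base ≃* Aut R.BN.base) (γ : RD.PiX ≃ₜ* RD.PiX)
    (hγ : ∀ y : RD.PiX, θΨ (rhoOfBiKummerData R ιX y) = rhoOfBiKummerData R ιX (γ y))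
    (hγL : RD.lDeltaTheta.map γ.toMulEquiv.toMonoidHom = RD.lDeltaTheta)
    (haΨ : ∀ (k : RD.PiYdd) (hk : (k : RD.PiX) ∈ RD.lDeltaTheta) (hk' : γ k ∈ RD.lDeltaTheta),
      (ofBiKummerData h toB Q odd_l R ιX hopen σ K' constEmb constEmb_injective hdivc hdivp).lDeltaModNMap β.hom
          (aΨ _ (e (RD.thetaMod ⟨k, hk⟩))) = e (RD.thetaMod ⟨γ k, hk'⟩)) :
    DeltaTransportCompat (ofBiKummerData h toB Q odd_l R ιX hopen σ K' constEmb constEmb_injective hdivc hdivp)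
      Ψ β aΨ θΨ P := by
  -- membership in `θ⁻¹(l·Δ_Θ)` forces membership in `Π^tp_Ÿ` (Prop. 2.14 (i): `(l·Δ_Θ) ⊆ (Δ^tp_Ÿ)^Θ`)
  have hY : ∀ k : RD.PiX, k ∈ RD.lDeltaTheta → k ∈ RD.PiYdd := fun k hk =>
    (Subgroup.mem_inf.mp (RD.lDeltaTheta_le hk)).1
  have hγL' : ∀ k : RD.PiX, k ∈ RD.lDeltaTheta → γ k ∈ RD.lDeltaTheta := by
    intro k hk
    rw [← hγL]
    exact Subgroup.mem_map.mpr ⟨k, hk, rfl⟩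
  refine deltaTransportCompat_of _ Ψ β aΨ θΨ P RD.lDeltaTheta (fun k => RD.thetaMod k) e γ
    (fun k _ => hγ k) hγL' ?_ ?_ ?_ ?_
  · intro k hk
    exact haΨ ⟨k, hY k hk⟩ hk (hγL' k hk)
  · intro g hg
    obtain ⟨k, hk, hkg⟩ := hcov g hg
    exact ⟨(k : RD.PiX), hk, hkg⟩
  · intro k hk
    exact hpre ⟨k, hY k hk⟩ hk
  · intro k hk hm
    exact hP ⟨k, hY k hk⟩ hk hm

end Genuine

end Thm56Sub

end ThetaFrobenioid

end Literature.AnabelianGeometry.EtaleTheta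

end
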